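import Summits.NavierStokesRegularity.NavierStokesRegularity.Theorems.TypeICertificateLadderTargetRateClassLiouville
import Summits.NavierStokesRegularity.NavierStokesRegularity.Theorems.DssFarFieldSlavingBlowupTypeIDssProfileSimilarityEnstrophyTimeOnlyThreshold

/-!
# The Leray floor in the currency of item 18385: every rung `X_C`, `C < 1`, of the Type-I certificate
# ladder is a THEOREM (item `TerminalTrace.TypeITraceScarL3`, stmt-NavierStokesRegularity-18385; ROUND-34 K1;
# also rung level of `TypeICertificateLadder`)

LANDING PLATE t35b prepared by the planner-of-record nsreg-p2 g31 (cell ns-regularity-ideate, ROUND-34 «the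
constant in T28-C», K1: «is the Leray-floor constant of `typeI_ancient_eq_zero_of_rate_lt_one` sharp inside our
class») for a PROVER seat; the planner lands nothing.  Pure composition of two tree theorems, no new
mathematics, 0 defs / 0 facts / 0 sorries:

* `SimilarityEnstrophy.timeOnlyThreshold_hypothesis` (T31⁗, p‑landed): every Oseen-gauge Type-I ancient mild
  field with constant `C < 1` vanishes (localised similarity-enstrophy bootstrap, rate `½(1 − C²)`);
* `typeIRung_of_rateClassLiouville C` (line `head-flux-channel`, landed): Liouville for the rate class at level
  `C` ⇒ the rung `X_C` — a classical Leray–Hopf solution from a rapidly decaying datum with eventual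
  dimensionless rate `√(T−t)‖u(t,x)‖ ≤ C√ν` extends classically past `T`.

Hence `typeIRung_of_rate_lt_one`: the rung `X_C` holds for every `0 < C < 1`, in exactly the binders of item
18385 / T27 / T28-C (`IsClassicalNSSolutionOn (Ico 0 T) ν 0 u p`, `IsLerayHopfOn T ν 0 (u 0) u`,
`HasRapidSpatialDecay (u 0)`, eventual rate).  CONSEQUENCE FOR ROUND-34: the windows `C² < 2ν` of
`typeITraceScarL3_of_eventualRate_sq_lt_two_nu` (T27) and `q < 1` of `typeITraceScarL3_of_logMean_lt` (T28-C,
constant rate `b = C/√(T−t)` has `q = C²/(2ν)`) carry content only on `ν ≤ C² < 2ν` (`½ ≤ q < 1`): below the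
Leray floor `C² < ν` there is no singular point at all.  Whether the floor constant `1` is sharp inside the class
`IsTypeIAncientMild` is the statement `∃ w, IsTypeIAncientMild 1 w ∧ ∃ t < 0, ∃ x, w t x ≠ 0` (equivalently, by
`extremalTypeIConstant_minimiserExists_proof` and T31⁗, the extremal constant `C⋆` of route
`ExtremalTypeIConstant` equals `1`) — a Type-I Liouville instance, not decided here.
WHAT THIS IS NOT: not `X_1`, not `NoTypeIBlowup`, not item 18385, not NS regularity.
[folklore composition; KNSS 2009 §6; this tree]
-/

noncomputable section

set_option linter.dupNamespace false

namespace Summit.NavierStokesRegularity.NavierStokesRegularity.Theorems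

open MeasureTheory Set Filter Topology
open Literature.Analysis.FluidPDE

/-- **Rung `X_C` of the Type-I certificate ladder for every `C < 1` (the tree's Leray floor, in the binders of
item 18385).**  A classical solution of unforced Navier–Stokes on `ℝ³ × [0,T)` (viscosity `ν > 0`), Leray–Hopf from
its rapidly decaying datum, with eventual rate `√(T−t)‖u(t,x)‖ ≤ C√ν` for some `0 < C < 1`, extends classically
past `T`.  Composition of `typeIRung_of_rateClassLiouville` with T31⁗ `SimilarityEnstrophy.timeOnlyThreshold_hypothesis`.
[folklore composition; KNSS 2009 §6; ROUND-34 K1] -/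
theorem typeIRung_of_rate_lt_one {C : ℝ} (hC : 0 < C) (hC1 : C < 1) :
    ∀ (ν T : ℝ), 0 < ν → 0 < T →
      ∀ (u : ℝ → EuclideanSpace ℝ (Fin 3) → EuclideanSpace ℝ (Fin 3))
        (p : ℝ → EuclideanSpace ℝ (Fin 3) → ℝ),
        IsClassicalNSSolutionOn (Set.Ico 0 T) ν 0 u p →
        IsLerayHopfOn T ν 0 (u 0) u →
        HasRapidSpatialDecay (u 0) →
        (∀ᶠ t in 𝓝[<] T, ∀ x, Real.sqrt (T - t) * ‖u t x‖ ≤ C * Real.sqrt ν) →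
        HasSmoothExtensionPast ν 0 u T :=
  typeIRung_of_rateClassLiouville C hC fun _ hu => SimilarityEnstrophy.timeOnlyThreshold_hypothesis hC1 hu

/-- **The same rung with the rate written as in item 18385 / T27** (`‖u(t,x)‖ ≤ C′/√(T−t)` with `C′² < ν`):
such a solution extends classically past `T`.  [folklore composition; ROUND-34 K1] -/
theorem hasSmoothExtensionPast_of_eventualRate_sq_lt_nu {C' : ℝ} (ν T : ℝ) (hν : 0 < ν) (hT : 0 < T)
    (hC' : C' ^ 2 < ν)
    (u : ℝ → EuclideanSpace ℝ (Fin 3) → EuclideanSpace ℝ (Fin 3)) (p : ℝ → EuclideanSpace ℝ (Fin 3) → ℝ)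
    (hcl : IsClassicalNSSolutionOn (Set.Ico 0 T) ν 0 u p) (hLH : IsLerayHopfOn T ν 0 (u 0) u)
    (hdec : HasRapidSpatialDecay (u 0))
    (hrate : ∀ᶠ t in 𝓝[<] T, ∀ x, ‖u t x‖ ≤ C' / Real.sqrt (T - t)) :
    HasSmoothExtensionPast ν 0 u T := by
  have hsν : 0 < Real.sqrt ν := Real.sqrt_pos.2 hν
  -- the dimensionless constant `C := max (|C'|, √ν/2) / √ν ∈ (0, 1)`
  set C : ℝ := max |C'| (Real.sqrt ν / 2) / Real.sqrt ν with hCdef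
  have hCpos : 0 < C := div_pos (lt_of_lt_of_le (by positivity) (le_max_right _ _)) hsν
  have habs : |C'| < Real.sqrt ν := by
    rw [← Real.sqrt_sq_eq_abs]
    exact Real.sqrt_lt_sqrt (sq_nonneg _) hC'
  have hC1 : C < 1 := by
    rw [hCdef, div_lt_one hsν]
    exact max_lt habs (by linarith)
  have hCν : max |C'| (Real.sqrt ν / 2) = C * Real.sqrt ν := by
    rw [hCdef, div_mul_cancel₀ _ hsν.ne']
  refine typeIRung_of_rate_lt_one hCpos hC1 ν T hν hT u p hcl hLH hdec ?_
  have hwin : ∀ᶠ t in 𝓝[<] T, t < T := eventually_nhdsWithin_of_forall fun t ht => ht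
  filter_upwards [hrate, hwin] with t ht htT x
  have hst : 0 < Real.sqrt (T - t) := Real.sqrt_pos.2 (by linarith)
  have h1 : Real.sqrt (T - t) * ‖u t x‖ ≤ C' := by
    have := ht x
    rw [le_div_iff₀ hst] at this
    linarith [this]
  calc Real.sqrt (T - t) * ‖u t x‖ ≤ C' := h1
    _ ≤ |C'| := le_abs_self _
    _ ≤ max |C'| (Real.sqrt ν / 2) := le_max_left _ _
    _ = C * Real.sqrt ν := hCν

end Summit.NavierStokesRegularity.NavierStokesRegularity.Theorems
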